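import Summits.AtomisticToContinuum.Crystallization.Theorems.OverbindingBudgetAffineFarCorePricingLipschitz
import Summits.AtomisticToContinuum.Crystallization.Theorems.OverbindingBudgetAffineFarTailSplit

/-!
# Overbinding budget — slot Z of the 31280 record, leaf Z3a `TailDriftBound`: part 1, DECAY SUMS over separated point sets

Analytic inputs of the proof of Z3a `TailDriftBound (1/25) (1/2000)` (`…OverbindingBudgetAffineFarTailDrift`):

* `separated_inv_pow_four_sum_le` — for a finite `s`-separated set `A ⊂ E3` of points of norm `≥ a > 0`,
  `Σ_{x∈A} ‖x‖⁻⁴ ≤ 2 (4a/s + 1)³ a⁻⁴`, UNIFORMLY in `#A` (dyadic shells: `#(A ∩ B(0, 2^{j+1}a)) ≤ (2^{j+2}a/s + 1)³ ≤ 8^j (4a/s+1)³` by the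
  Literature packing count `card_le_of_separated_of_dist_le`, against the weight `(2^j a)⁻⁴ = 16^{-j} a⁻⁴`; Mathlib `sum_geometric_two_le`);
* `abs_lennardJones_sub_le_decay` — the DECAYING Lipschitz estimate `|V ρ − V r| ≤ 256 |ρ − r| / r⁷` for `r ≥ 2`, `ρ ≥ r/2`
  (tree `abs_lennardJones_sub_le` on `[r/2, ∞)`);
* `tailW_eq_zero` — the tail weight vanishes below `4.5·nn`.

[this file: Summit.AtomisticToContinuum.Crystallization, slot Z of the 31280 record, leaf Z3a part 1]
-/

namespace Summit.AtomisticToContinuum.Crystallization.Theorems.OverbindingBudgetAffineFarSmoothSplit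

open Literature.MathematicalPhysics.StatisticalMechanics
open Literature.Geometry.DiscreteGeometry
open scoped Classical

/-! ## §1  Dyadic decay sums over separated sets -/

/-- **Packing count in a ball** (Literature `card_le_of_separated_of_dist_le` in `E3`): an `s`-separated finite set inside `B(0, R)` has at most
`(2R/s + 1)³` points. [this file] -/
theorem card_filter_norm_le {A : Finset (EuclideanSpace ℝ (Fin 3))} {s : ℝ} (hs : 0 < s)
    (hsep : ∀ x ∈ A, ∀ x' ∈ A, x ≠ x' → s ≤ dist x x') {R : ℝ} (hR : 0 ≤ R) :
    ((A.filter fun x => ‖x‖ < R).card : ℝ) ≤ (2 * R / s + 1) ^ 3 := by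
  have h1 : ∀ x ∈ A.filter (fun x => ‖x‖ < R), dist x 0 ≤ R := by
    intro x hx
    rw [Finset.mem_filter] at hx
    rw [dist_zero_right]
    exact hx.2.le
  have h2 : ∀ x ∈ A.filter (fun x => ‖x‖ < R), ∀ x' ∈ A.filter (fun x => ‖x‖ < R), x ≠ x' → s ≤ dist x x' :=
    fun x hx x' hx' hne => hsep x (Finset.mem_filter.mp hx).1 x' (Finset.mem_filter.mp hx').1 hne
  have h3 := card_le_of_separated_of_dist_le (A.filter fun x => ‖x‖ < R) 0 hs hR h1 h2
  rw [finrank_euclideanSpace_fin] at h3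
  exact_mod_cast h3

/-- **One dyadic shell**: the weight `(2^j a)⁻⁴` against the packing count of `B(0, 2^{j+1} a)` is `≤ (4a/s + 1)³ a⁻⁴ · 2^{-j}`. [this file] -/
theorem dyadic_shell_bound {s a : ℝ} (hs : 0 < s) (ha : 0 < a) (j : ℕ) :
    (2 * (2 ^ (j + 1) * a) / s + 1) ^ 3 * ((2 : ℝ) ^ j * a)⁻¹ ^ 4 ≤ (4 * a / s + 1) ^ 3 * a⁻¹ ^ 4 * ((2 : ℝ) ^ j)⁻¹ := by
  set t : ℝ := 2 ^ j with ht
  have ht1 : 1 ≤ t := one_le_pow₀ (by norm_num)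
  have ht0 : 0 < t := by positivity
  have has : 0 ≤ 4 * a / s := by positivity
  have e1 : 2 * (2 ^ (j + 1) * a) / s + 1 = 4 * a / s * t + 1 := by rw [pow_succ]; ring
  have e2 : (t * a)⁻¹ ^ 4 = t⁻¹ ^ 4 * a⁻¹ ^ 4 := by rw [mul_inv, mul_pow]
  rw [e1, e2]
  have h1 : 4 * a / s * t + 1 ≤ t * (4 * a / s + 1) := by nlinarith
  have h2 : (4 * a / s * t + 1) ^ 3 ≤ t ^ 3 * (4 * a / s + 1) ^ 3 := by
    rw [← mul_pow]; exact pow_le_pow_left₀ (by positivity) h1 3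
  have h3 : t ^ 3 * t⁻¹ ^ 4 = t⁻¹ := by field_simp
  calc (4 * a / s * t + 1) ^ 3 * (t⁻¹ ^ 4 * a⁻¹ ^ 4)
      ≤ t ^ 3 * (4 * a / s + 1) ^ 3 * (t⁻¹ ^ 4 * a⁻¹ ^ 4) := mul_le_mul_of_nonneg_right h2 (by positivity)
    _ = (4 * a / s + 1) ^ 3 * a⁻¹ ^ 4 * (t ^ 3 * t⁻¹ ^ 4) := by ring
    _ = (4 * a / s + 1) ^ 3 * a⁻¹ ^ 4 * t⁻¹ := by rw [h3]

/-- **Decay sum over a separated set.**  For a finite `s`-separated set `A ⊂ E3` of points of norm `≥ a > 0`: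
`Σ_{x∈A} ‖x‖⁻⁴ ≤ 2 (4a/s + 1)³ a⁻⁴` — uniformly in `#A`.  (Each `x` sits in a dyadic shell `2^j a ≤ ‖x‖ < 2^{j+1} a`, so `‖x‖⁻⁴ ≤ Σ_j
[‖x‖ < 2^{j+1} a]·(2^j a)⁻⁴`; exchange the sums, count each ball by packing, and sum the dyadic series.) [this file] -/
theorem separated_inv_pow_four_sum_le (A : Finset (EuclideanSpace ℝ (Fin 3))) {s a : ℝ} (hs : 0 < s) (ha : 0 < a)
    (hA : ∀ x ∈ A, a ≤ ‖x‖) (hsep : ∀ x ∈ A, ∀ x' ∈ A, x ≠ x' → s ≤ dist x x') :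
    ∑ x ∈ A, ‖x‖⁻¹ ^ 4 ≤ 2 * (4 * a / s + 1) ^ 3 * a⁻¹ ^ 4 := by
  -- dyadic index of each point
  have hx1 : ∀ x ∈ A, 1 ≤ ‖x‖ / a := fun x hx => by rw [le_div_iff₀ ha, one_mul]; exact hA x hx
  set n : EuclideanSpace ℝ (Fin 3) → ℕ := fun x =>
    if h : 1 ≤ ‖x‖ / a then Classical.choose (exists_nat_pow_near h one_lt_two) else 0 with hn_def
  have hn : ∀ x ∈ A, (2 : ℝ) ^ n x * a ≤ ‖x‖ ∧ ‖x‖ < 2 ^ (n x + 1) * a := by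
    intro x hx
    have h := hx1 x hx
    have e : n x = Classical.choose (exists_nat_pow_near h one_lt_two) := by rw [hn_def]; exact dif_pos h
    have hspec := Classical.choose_spec (exists_nat_pow_near h one_lt_two)
    rw [← e] at hspec
    rw [le_div_iff₀ ha] at hspec
    rw [div_lt_iff₀ ha] at hspec
    exact hspec
  set J := A.sup n with hJ_def
  have hJ : ∀ x ∈ A, n x ≤ J := fun x hx => Finset.le_sup hx
  -- the dyadic majorant of each term
  set F : ℕ → EuclideanSpace ℝ (Fin 3) → ℝ := fun j x => if ‖x‖ < 2 ^ (j + 1) * a then ((2 : ℝ) ^ j * a)⁻¹ ^ 4 else 0 with hF_def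
  have hF0 : ∀ j x, 0 ≤ F j x := fun j x => by
    simp only [hF_def]; split_ifs
    · positivity
    · exact le_rfl
  have hpt : ∀ x ∈ A, ‖x‖⁻¹ ^ 4 ≤ ∑ j ∈ Finset.range (J + 1), F j x := by
    intro x hx
    obtain ⟨hlo, hhi⟩ := hn x hx
    have hmem : n x ∈ Finset.range (J + 1) := Finset.mem_range.mpr (Nat.lt_succ_of_le (hJ x hx))
    refine le_trans ?_ (Finset.single_le_sum (fun j _ => hF0 j x) hmem)
    show ‖x‖⁻¹ ^ 4 ≤ F (n x) x
    simp only [hF_def, if_pos hhi]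
    have h0 : (0 : ℝ) < 2 ^ n x * a := by positivity
    exact pow_le_pow_left₀ (inv_nonneg.mpr (norm_nonneg x)) (inv_anti₀ h0 hlo) 4
  -- exchange the sums and count each ball
  have hball : ∀ j ∈ Finset.range (J + 1), ∑ x ∈ A, F j x ≤ (4 * a / s + 1) ^ 3 * a⁻¹ ^ 4 * ((2 : ℝ) ^ j)⁻¹ := by
    intro j _
    have e : ∑ x ∈ A, F j x = ((A.filter fun x => ‖x‖ < 2 ^ (j + 1) * a).card : ℝ) * ((2 : ℝ) ^ j * a)⁻¹ ^ 4 := by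
      simp only [hF_def]
      rw [← Finset.sum_filter, Finset.sum_const, nsmul_eq_mul]
    rw [e]
    have hc := card_filter_norm_le hs hsep (R := 2 ^ (j + 1) * a) (by positivity)
    exact le_trans (mul_le_mul_of_nonneg_right hc (by positivity)) (dyadic_shell_bound hs ha j)
  calc ∑ x ∈ A, ‖x‖⁻¹ ^ 4 ≤ ∑ x ∈ A, ∑ j ∈ Finset.range (J + 1), F j x := Finset.sum_le_sum hpt
    _ = ∑ j ∈ Finset.range (J + 1), ∑ x ∈ A, F j x := Finset.sum_comm
    _ ≤ ∑ j ∈ Finset.range (J + 1), (4 * a / s + 1) ^ 3 * a⁻¹ ^ 4 * ((2 : ℝ) ^ j)⁻¹ := Finset.sum_le_sum hball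
    _ = (4 * a / s + 1) ^ 3 * a⁻¹ ^ 4 * ∑ j ∈ Finset.range (J + 1), ((2 : ℝ) ^ j)⁻¹ := by rw [Finset.mul_sum]
    _ ≤ (4 * a / s + 1) ^ 3 * a⁻¹ ^ 4 * 2 := by
        refine mul_le_mul_of_nonneg_left ?_ (by positivity)
        have e : ∀ j : ℕ, ((2 : ℝ) ^ j)⁻¹ = (1 / 2) ^ j := fun j => by rw [← inv_pow, one_div]
        simp_rw [e]
        exact sum_geometric_two_le (J + 1)
    _ = 2 * (4 * a / s + 1) ^ 3 * a⁻¹ ^ 4 := by ring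

/-! ## §2  Lennard-Jones at long range and the tail weight below its support -/

/-- **Decaying Lipschitz estimate**: `|V ρ − V r| ≤ 256 |ρ − r| / r⁷` for `r ≥ 2` and `ρ ≥ r/2` (the tree's `abs_lennardJones_sub_le` on
`[r/2, ∞)`: `(r/2)⁻¹³ + (r/2)⁻⁷ ≤ 2 (2/r)⁷`). [this file] -/
theorem abs_lennardJones_sub_le_decay {ρ r : ℝ} (hr : 2 ≤ r) (hρ : r / 2 ≤ ρ) :
    |lennardJones ρ - lennardJones r| ≤ 256 * |ρ - r| / r ^ 7 := by
  have hm : 0 < r / 2 := by linarith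
  have h := OverbindingBudgetPatchContinuity.abs_lennardJones_sub_le hm hρ (by linarith : r / 2 ≤ r)
  have hm1 : (r / 2)⁻¹ ≤ 1 := inv_le_one_of_one_le₀ (by linarith)
  have hm0 : 0 ≤ (r / 2)⁻¹ := inv_nonneg.mpr hm.le
  have h13 : (r / 2)⁻¹ ^ 13 ≤ (r / 2)⁻¹ ^ 7 := pow_le_pow_of_le_one hm0 hm1 (by norm_num)
  have e7 : (r / 2)⁻¹ ^ 7 = 128 / r ^ 7 := by
    rw [inv_pow, div_pow]; field_simp; norm_num
  have hr7 : 0 < r ^ 7 := by positivity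
  calc |lennardJones ρ - lennardJones r| ≤ ((r / 2)⁻¹ ^ 13 + (r / 2)⁻¹ ^ 7) * |ρ - r| := h
    _ ≤ (2 * (r / 2)⁻¹ ^ 7) * |ρ - r| := mul_le_mul_of_nonneg_right (by linarith) (abs_nonneg _)
    _ = 256 * |ρ - r| / r ^ 7 := by rw [e7]; field_simp; ring

/-- `|V r| ≤ 1/(4 r⁶)` for `r ≥ 1` (Literature `abs_lennardJones_le`), in the form `|V r| ≤ (1/4) r⁻¹⁴ · r⁻¹²`-free: `|V r| · r ^ 6 ≤ 1/4`.
[this file] -/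
theorem abs_lennardJones_mul_pow_six_le {r : ℝ} (hr : 1 ≤ r) : |lennardJones r| * r ^ 6 ≤ 1 / 4 := by
  have h := Literature.MathematicalPhysics.StatisticalMechanics.abs_lennardJones_le hr
  have hr0 : 0 < r := by linarith
  have e : r⁻¹ ^ 6 * r ^ 6 = 1 := by rw [inv_pow, inv_mul_cancel₀ (pow_ne_zero 6 hr0.ne')]
  calc |lennardJones r| * r ^ 6 ≤ 1 / 4 * r⁻¹ ^ 6 * r ^ 6 := mul_le_mul_of_nonneg_right h (by positivity)
    _ = 1 / 4 := by rw [mul_assoc, e, mul_one]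

/-- The tail weight vanishes below `4.5·nn`. [this file] -/
theorem tailW_eq_zero {nn ρ : ℝ} (hnn : 0 < nn) (h : ρ ≤ 9 / 2 * nn) : tailW nn ρ = 0 := by
  have ht : (ρ / nn - 9 / 2) / (43 / 10) ≤ 0 := by
    apply div_nonpos_of_nonpos_of_nonneg _ (by norm_num)
    rw [sub_nonpos, div_le_iff₀ hnn]; linarith
  unfold tailW sigma15
  rw [if_pos ht]

/-- A tail summand is `≤ 0` once `nn ≥ 9/10`: below `4.5·nn` the weight vanishes, above it `V ≤ 0` (`4.5·nn ≥ 1`). [this file] -/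
theorem tailW_mul_lennardJones_nonpos {nn ρ : ℝ} (hnn : 9 / 10 ≤ nn) : tailW nn ρ * lennardJones ρ ≤ 0 := by
  by_cases h : ρ ≤ 9 / 2 * nn
  · rw [tailW_eq_zero (by linarith) h, zero_mul]
  · push Not at h
    exact mul_nonpos_iff.mpr (Or.inl ⟨tailW_nonneg nn ρ, lennardJones_nonpos (by linarith)⟩)

end Summit.AtomisticToContinuum.Crystallization.Theorems.OverbindingBudgetAffineFarSmoothSplit
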